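import Summits.QuantumFields.YangMills.Theorems.BalabanUVNodesN13UV01LevelZeroOfNormalisationLettersAtRecord13

/-!
# BalabanUVNodes ∕ K1⁹ — THE (B)-SLOT AND THE DECIDING CRUX BY NAME FROM «THEOREM 1 + THE FOUR NORMALISATION ITEMS + ROW (iv) + (2.50) A.E. ABOVE LEVEL 0 + THE ROWS»:
# p632548 §4 with the coupling-blind letters `θ.Efl ≡ 0 ∧ θ.logz ≡ 0` (FLAG №9) REPLACED by the displayed items of `…N13UV01LevelZeroOfNormalisationLettersAtRecord13`

Cell `pub-ymgap` (D-0062 Track A ∕ D-0149 width), WIDTH SEAT `pub-ymgap-dag-n13-w1` (gen 6, CLAIM-2), key K1⁹ `StabilityBRunRowsAtRecordR13SepCoPHV` = stmt-QuantumFields-27364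
(`route-QuantumFields-BalabanUVNodes` rev 29; `--kind proof --supports … --as helper`; count-neutral).  OWN LINEAGE: g5's p622796 (the route-free slot junction
`exists_revision₁₃_endStatementBPrinted_of_ae`), p623627 ∕ p627940 §2 ∕ p632548 §4 (the K1⁹ supplier templates keyed to `Efl ≡ 0 ∧ logz ≡ 0` — VACUOUS-IN-REGIME as witness roads
by director-ym №218 FLAG №9 and dag-n13-w3's p637054 `k1R9Body_false_of_logz_zero_Efl_zero`), g6 CLAIM-1 (the level-0 face under the four items).

WHAT THIS FILE PROVES (`N = 2`; two theorems, 0 `def`).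
* ★★ `exists_revision₁₃_endStatementBPrinted_of_aeSucc_of_runPartialSumFloor_of_normLetters` — the K1⁹ (B)-slot `∃ v, B16.EndStatementBPrinted (datumOfRecord₁₃SepCoPHV F 2 θ h v).C`
  from: [II] Theorem 1's clause at the record; the four normalisation items (z two-sided `aL·log g_j − CzL ≤ logz_j ≤ aU·log g_j + CzU`, `aL, aU ≤ 4d(𝔤)`; Efl two-sided volume
  bounds) on every γ-windowed run (`0 < γ ≤ 1`, `γ ≤ γ₀`); K1⁹'s row (iv) (run-wise partial-sum floor of `β_θ` at level `γ₀`); exponents `em ep` with (2.50) `dV_{k+1}`-a.e. at levels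
  `k+1 ≤ K` — level 0 at EVERY field by CLAIM-1 §4, exponent pairs merged by `max`, then p622796.
* ★★★ `stabilityBRunRowsAtRecordR13SepCoPHV_of_aeSuccRoad_rows_of_normLetters` — K1⁹ BY NAME from the road «∀ F, Inhabited13 F → ∃ θ h, (unity ∧ slots) ∧ Admissible ∧ Thm1Printed
  (record) ∧ ∃ γ > 0, (∃ item constants, the four items on γ-windowed runs) ∧ (∃ em ep, (2.50) a.e. above level 0 on γ-windowed runs) ∧ RunRowsCont13 F θ» (window shrunk to
  `min γ (min γ₀ 1)` inside; row (i) gives the window conjunct via `…K1R9WindowConjunctIdle`).  Print's `z` ([I] (0.15) at `α = g_j²`) meets the z-items by CLAIM-1's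
  `zItems_of_logz_eq_log_zNorm` (`aL = d(𝔤)`, `aU = 0`), so THIS template is not confined to the coupling-blind class.

HONEST FRAMING.  By-name composition; CONDITIONAL on the displayed hypotheses — the a.e. Cor-3 rows at levels `≥ 1` remain THE open analytic entry of the (B)-face and the
normalisation items remain hypotheses on the witness's letters; K1⁹ (deciding crux) NEITHER proved NOR refuted; N13 NOT discharged; no stub closed; counts unmoved
(typed 28∕28 · discharged 5∕27 · A 5∕28); one finite `𝕋⁴_{L^K}` programme at fixed ε; R4 closes the CONDITIONAL finite-𝕋⁴ rung `BalabanLadder.UV` only — the Yang–Mills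
mass gap (Clay) is NOT proved by any of this.  No `sorry`, `def`, `instance`, `notation`; standard axioms.
-/

noncomputable section

open scoped BigOperators

namespace Summit.QuantumFields.YangMills.BalabanUVNodes.K1R9SlotOfAESuccNormalisationLettersAtRecord

open MeasureTheory
open Literature.MathematicalPhysics.QuantumFieldTheory.Balaban1983to89
open Literature.MathematicalPhysics.QuantumFieldTheory.Balaban1983to89.T4Continuum
open Literature.MathematicalPhysics.QuantumFieldTheory.Balaban1983to89.Node00
open Literature.MathematicalPhysics.QuantumFieldTheory.Balaban1983to89.FlowStepRuns (genFlow genSeq genSeq_zero)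
open Literature.MathematicalPhysics.QuantumFieldTheory.Balaban1983to89.FlowStep (HBeta prefixOf RGEqH)
open Literature.MathematicalPhysics.QuantumFieldTheory.Balaban1983to89.T4DatumAssembly.TowerReviseAE (uvIneq_mono_upper)
open Summit.QuantumFields.YangMills.BalabanUVNodes.K1R9VersionSlotOfAEAtRecord (exists_revision₁₃_endStatementBPrinted_of_ae)
open Summit.QuantumFields.YangMills.BalabanUVNodes.K1R9SlotOfAESuccLevelZeroAtRecord (uvIneq_mono_lower chi_datumOfRecord₁₃SepCoPH_nonneg)
open Summit.QuantumFields.YangMills.BalabanUVNodes.N13UV01LevelZeroOfNormalisationLettersAtRecord13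
  (uvIneq_zero_datumOfRecord₁₃CoPH_of_normLetters_of_inInterval_of_runPartialSumFloor)
open Summit.QuantumFields.YangMills.Theorems.K1V6Defs (Inhabited13)
open Summit.QuantumFields.YangMills.Theorems.BalabanUVNodesK1R8RowsDefs (RunRowsCont13)
open Summit.QuantumFields.YangMills.Theorems.BalabanUVNodesK1R9WindowConjunctIdle (stabilityBRunRowsAtRecordR13SepCoPHV_of_windowFree)
open Summit.QuantumFields.YangMills.Theses.BalabanUVNodes (StabilityBRunRowsAtRecordR13SepCoPHV)

/-- ★★ **THE K1⁹ (B)-SLOT FROM THEOREM 1's CLAUSE + THE FOUR NORMALISATION ITEMS ON γ-WINDOWED RUNS + ROW (iv) + (2.50) `dV_{k+1}`-A.E. AT LEVELS `k+1 ≤ K`** (`0 < γ ≤ 1`, `γ ≤ γ₀`):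
p632548's `exists_revision₁₃_endStatementBPrinted_of_aeSucc_of_runPartialSumFloor` with `θ.Efl ≡ 0 ∧ θ.logz ≡ 0` replaced by the items (z two-sided with `aL, aU ≤ 4d(𝔤)`; Efl two-sided
volume bounds), level 0 supplied at EVERY field by `…NormalisationLettersAtRecord13` §4, exponent pairs merged by `max`, then the route-free junction `exists_revision₁₃_endStatementBPrinted_of_ae`
(p622796).  [cite: Balaban1989LargeFieldII, Thm 1 + (0.1) pp.355–356; Balaban1988Convergent, (2.18) p.257, Cor. 3 (2.50) p.264, (1.15) p.249; Balaban1987RG1, (0.15) p.254, (0.20) p.256, Thm 2 p.259] -/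
theorem exists_revision₁₃_endStatementBPrinted_of_aeSucc_of_runPartialSumFloor_of_normLetters {F : T4Family} (θ : Stage13HParams F 2) (h : θ.Provisos₁₃SepCoPH F 2)
    {γ γ₀ M : ℝ} (hγ : 0 < γ) (hγ1 : γ ≤ 1) (hγ₀ : γ ≤ γ₀)
    (hps : ∀ (n : ℕ) (gs : ℕ → ℝ), RGEqH n (betaOfRecord₁₃ F 2 θ.toStage13Params) gs → Step.InInterval γ₀ n gs →
      ∀ k, k ≤ n → -M ≤ ∑ j ∈ Finset.Ico k n, betaOfRecord₁₃ F 2 θ.toStage13Params j (prefixOf gs j))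
    {aL aU CzL CzU CEL CEU : ℝ} (haL : aL ≤ 4 * ((dimSU 2 : ℕ) : ℝ)) (haU : aU ≤ 4 * ((dimSU 2 : ℕ) : ℝ))
    (hCzL : 0 ≤ CzL) (hCzU : 0 ≤ CzU) (hCEL : 0 ≤ CEL) (hCEU : 0 ≤ CEU)
    (hitems : ∀ p : B12.RunParams, ((datumOfRecord₁₃SepCoPH F 2 θ h).C p).flow.InInterval γ p.K → ∀ j, j < p.K →
      (aL * Real.log (gOfRecord₁₃ F 2 θ.toStage13Params p j) - CzL ≤ θ.logz p j ∧ θ.logz p j ≤ aU * Real.log (gOfRecord₁₃ F 2 θ.toStage13Params p j) + CzU) ∧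
      (-(CEL * sitesCard (F.P p.K) (j + 1)) ≤ θ.Efl p j ∧ θ.Efl p j ≤ CEU * sitesCard (F.P p.K) (j + 1)))
    (h1 : B16.Thm1Printed (datumOfRecord₁₃SepCoPH F 2 θ h).C) (em ep : ℝ → ℝ)
    (hae : ∀ p : B12.RunParams, ((datumOfRecord₁₃SepCoPH F 2 θ h).C p).flow.InInterval γ p.K → ∀ k : ℕ, k + 1 ≤ p.K →
      ∀ᵐ V ∂fieldMeasure (F.P p.K) (k + 1) (SU 2),
        B16.UVIneq ((datumOfRecord₁₃SepCoPH F 2 θ h).C p) (k + 1) V (em (((datumOfRecord₁₃SepCoPH F 2 θ h).C p).flow.g (k + 1)))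
          (ep (((datumOfRecord₁₃SepCoPH F 2 θ h).C p).flow.g (k + 1)))) :
    ∃ v : Revision₁₃ F 2 θ h, B16.EndStatementBPrinted (datumOfRecord₁₃SepCoPHV F 2 θ h v).C := by
  -- the level-0 exponents (letter version) and the merged pair
  let em₀ : ℝ → ℝ := fun g => 4 * max θ.ν.logσ₀ 0 + CzL + CEU + 12 * (1 / g) ^ 2
  let ep₀ : ℝ → ℝ := fun g => (4 * ((dimSU 2 : ℕ) : ℝ) - aU) * (Real.log g⁻¹ + M / 2) + 4 * max (-θ.ν.logσ₀) 0 + CzU + CEL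
  let em' : ℝ → ℝ := fun g => max (em g) (em₀ g)
  let ep' : ℝ → ℝ := fun g => max (ep g) (ep₀ g)
  refine exists_revision₁₃_endStatementBPrinted_of_ae θ h hγ em' ep' h1 ?_ ?_
  · -- level 0 at EVERY field from row (iv) + the items, then enlarge both exponents
    intro p hp V
    have hit := hitems p hp
    have h0 := uvIneq_zero_datumOfRecord₁₃CoPH_of_normLetters_of_inInterval_of_runPartialSumFloor θ h.toCore p hγ1 hγ₀ hps hp
      haL haU hCzL hCzU hCEL hCEU (fun j hj => (hit j hj).1.1) (fun j hj => (hit j hj).1.2) (fun j hj => (hit j hj).2.1) (fun j hj => (hit j hj).2.2) V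
    have h0' : B16.UVIneq ((datumOfRecord₁₃SepCoPH F 2 θ h).C p) 0 V (em₀ (((datumOfRecord₁₃SepCoPH F 2 θ h).C p).flow.g 0))
        (ep₀ (((datumOfRecord₁₃SepCoPH F 2 θ h).C p).flow.g 0)) := h0
    exact uvIneq_mono_upper (uvIneq_mono_lower (chi_datumOfRecord₁₃SepCoPH_nonneg θ h p 0 V) h0' (le_max_right _ _)) (le_max_right _ _)
  · -- levels ≥ 1 a.e.: enlarge both exponents inside the a.e. statement
    intro p hp k hk
    filter_upwards [hae p hp k hk] with V hV
    exact uvIneq_mono_upper (uvIneq_mono_lower (chi_datumOfRecord₁₃SepCoPH_nonneg θ h p (k + 1) V) hV (le_max_left _ _)) (le_max_left _ _)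

/-- ★★★ **THE DECIDING CRUX BY NAME FROM «THEOREM 1 + THE NORMALISATION ITEMS + (2.50) A.E. ABOVE LEVEL 0 + THE ROWS» — NO COUPLING-BLIND LETTER.**  K1⁹
`…Theses.BalabanUVNodes.StabilityBRunRowsAtRecordR13SepCoPHV` (stmt-QuantumFields-27364) follows from: at ONE witness `(θ, h)` per family with an admissible unity tuple — (unity ∧ slots),
admissibility, [II] Theorem 1's clause at the record, SOME window `γ > 0` on whose runs the witness's normalisation letters obey the four items (z two-sided of [I] (0.15) shape with
coefficients `≤ 4d(𝔤)`, Efl two-sided volume bounds of [I] (2.13)–(2.14) shape — print's `z` meets them by `…NormalisationLettersAtRecord13.zItems_of_logz_eq_log_zNorm`), exponents `em ep`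
with [III] Cor. 3 (2.50) `dV_{k+1}`-a.e. at levels `k+1 ≤ K` of every γ-windowed run (THE ONE OPEN ANALYTIC ENTRY of the (B)-face), and the rows `RunRowsCont13 F θ` THE CRUX ALREADY ASKS.
p632548's `…_of_aeSuccRoad_rows` with `θ.Efl ≡ 0 ∧ θ.logz ≡ 0` (the FLAG №9 letters) replaced by the items; inside the proof the window is shrunk to `min γ (min γ₀ 1)`.  CONDITIONAL on
the displayed hypotheses; K1⁹ NOT closed here; nothing of Bałaban's Cor. 3 above level 0 asserted.
[cite: Balaban1989LargeFieldII, Thm 1 + (0.1) pp.355–356; Balaban1988Convergent, (2.18) p.257, Cor. 3 (2.50) p.264, (1.15) p.249; Balaban1987RG1, (0.15) p.254, Thm 2 p.259, Thm 3 p.264, (5.10) p.293] -/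
theorem stabilityBRunRowsAtRecordR13SepCoPHV_of_aeSuccRoad_rows_of_normLetters
    (hroad : ∀ F : T4Family, Inhabited13 F → ∃ (θ : Stage13HParams F 2) (h : θ.Provisos₁₃SepCoPH F 2),
      (θ.ZhUnity F 2 ∧ θ.SlotsNondegenerate₁₃ F 2) ∧ θ.Admissible F 2 ∧
      B16.Thm1Printed (datumOfRecord₁₃SepCoPH F 2 θ h).C ∧
      (∃ γ : ℝ, 0 < γ ∧
        (∃ aL aU CzL CzU CEL CEU : ℝ, aL ≤ 4 * ((dimSU 2 : ℕ) : ℝ) ∧ aU ≤ 4 * ((dimSU 2 : ℕ) : ℝ) ∧ 0 ≤ CzL ∧ 0 ≤ CzU ∧ 0 ≤ CEL ∧ 0 ≤ CEU ∧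
          ∀ p : B12.RunParams, ((datumOfRecord₁₃SepCoPH F 2 θ h).C p).flow.InInterval γ p.K → ∀ j, j < p.K →
            (aL * Real.log (gOfRecord₁₃ F 2 θ.toStage13Params p j) - CzL ≤ θ.logz p j ∧
              θ.logz p j ≤ aU * Real.log (gOfRecord₁₃ F 2 θ.toStage13Params p j) + CzU) ∧
            (-(CEL * sitesCard (F.P p.K) (j + 1)) ≤ θ.Efl p j ∧ θ.Efl p j ≤ CEU * sitesCard (F.P p.K) (j + 1))) ∧
        ∃ em ep : ℝ → ℝ,
          ∀ p : B12.RunParams, ((datumOfRecord₁₃SepCoPH F 2 θ h).C p).flow.InInterval γ p.K → ∀ k : ℕ, k + 1 ≤ p.K →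
            ∀ᵐ V ∂fieldMeasure (F.P p.K) (k + 1) (SU 2),
              B16.UVIneq ((datumOfRecord₁₃SepCoPH F 2 θ h).C p) (k + 1) V (em (((datumOfRecord₁₃SepCoPH F 2 θ h).C p).flow.g (k + 1)))
                (ep (((datumOfRecord₁₃SepCoPH F 2 θ h).C p).flow.g (k + 1)))) ∧
      RunRowsCont13 F θ) :
    StabilityBRunRowsAtRecordR13SepCoPHV := by
  refine stabilityBRunRowsAtRecordR13SepCoPHV_of_windowFree fun F hinh => ?_
  obtain ⟨θ, h, hU, hθ, h1, ⟨γ, hγ, ⟨aL, aU, CzL, CzU, CEL, CEU, haL, haU, hCzL, hCzU, hCEL, hCEU, hitems⟩, em, ep, hae⟩, hrows⟩ := hroad F hinh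
  have hrows' := hrows
  obtain ⟨b, r, γ₀, M, hγ₀, -, hps, -⟩ := hrows'
  -- shrink the window to `γ' := min γ (min γ₀ 1)`
  have hγ' : 0 < min γ (min γ₀ 1) := lt_min hγ (lt_min hγ₀ one_pos)
  have hγ'γ : min γ (min γ₀ 1) ≤ γ := min_le_left _ _
  have hγ'1 : min γ (min γ₀ 1) ≤ 1 := (min_le_right _ _).trans (min_le_right _ _)
  have hγ'₀ : min γ (min γ₀ 1) ≤ γ₀ := (min_le_right _ _).trans (min_le_left _ _)
  have hsub : ∀ p : B12.RunParams, ((datumOfRecord₁₃SepCoPH F 2 θ h).C p).flow.InInterval (min γ (min γ₀ 1)) p.K →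
      ((datumOfRecord₁₃SepCoPH F 2 θ h).C p).flow.InInterval γ p.K :=
    fun p hp i hi => ⟨(hp i hi).1, (hp i hi).2.trans hγ'γ⟩
  obtain ⟨v, hB⟩ := exists_revision₁₃_endStatementBPrinted_of_aeSucc_of_runPartialSumFloor_of_normLetters θ h hγ' hγ'1 hγ'₀ hps
    haL haU hCzL hCzU hCEL hCEU (fun p hp => hitems p (hsub p hp)) h1 em ep (fun p hp k hk => hae p (hsub p hp) k hk)
  exact ⟨θ, h, v, hU, hθ, hB, hrows⟩

end Summit.QuantumFields.YangMills.BalabanUVNodes.K1R9SlotOfAESuccNormalisationLettersAtRecord
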